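/-
Copyright (c) 2026 the pub-hodgecm-mathlib formalisation cell (harness21).  Prover seat hodgecm-mathlib-LH4-p04 (g6), req620 Track A «(D-RAM) FOUR-FRAME» squad
(STAGE-1b pre-scoping, heir LEAD F0P3a-plan (g20) T19-24 clause; dealer LH4-plan (g12) board, row (2) column; co-hand under LH4-p07 (g8)'s row-(2) lead), 2026-09-04.
-/
import Summits.HodgeConjecture.HodgeConjecture.Theorems.F0P3cDyRamToricLevelCensusUnrDep   -- ★ T5a (LH4-p08 (g4)): (D0) `dep_iff_of_witness`, (R1-OFF) `levelSetDep_eq_of_offDiag` ∕ `ncard_levelSetDep_offDiag`; brings ★ DEFS `levelSet ∕ levelSetDep ∕ IsOrd ∕ dualGen`, ★ T4 `QuadraticOrder*`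
import HarnessLib

/-!
# T5a-P (type U): TWO-MULTIPLIER cells of the depth-refined toric level census REDUCE to ONE-MULTIPLIER cells behind a lattice-free guard — the M∕E-UNRAMIFIED twin
# `levelSetDep(j,a;μ₁) ∩ levelSetDep(j,a;μ₂) = [j + a ≤ m₂ ∨ |ρμ₁∕μ₁ − ρμ₂∕μ₂| ≤ exp(−((j + a) − m₂))] · levelSetDep(j,a;μ₁)`  (`|μ₁| = exp(−m₁) ≥ |μ₂| = exp(−m₂)`)

Cell `hodgecm-mathlib` (D-0151), FLOOR 0, crux item H413 = `stmt-HodgeConjecture-24833`, route of record `HCCMUnconditional`; squad F0∕P3c∕LH4; lane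
`--supports stmt-HodgeConjecture-24833 --as helper` (count-neutral; pays NO tier-0 row; the STAGE-1b rows `stub_rows_transvPlus ∕ transvMinus ∕ regular` stay OPEN).
THEOREMS ONLY (no `def`, no instance, no notation, no `sorry`, default heartbeats).  STAGE-1b TYPED INVENTORY for the chair's PLAN-T1 v19, row (2) column: the type-U third
of LH4-p07 (g8) PRESCOPE-type2-rows §4 (T5-P) «two-multiplier ∕ mixed-conductor toric level tables and sums, ×3 third-field types», twin of ★ `…ToricLevelCensusRamMTwoMult`
(this seat, ★ p858876 — the RamM third) in the unramified tokens of ★ T5a `…ToricLevelCensusUnrDep` (`|ϖE| = exp(−1)`, `|α − ρα| = 1`, `|μᵢ| = exp(−mᵢ)`).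

THE OBJECT (as in the RamM twin).  On ROW (2) of the unlabelled STAGE-1b pieces the square token `(Γ − 1)²·M ⊆ ϖ^b·M` brings a SECOND multiplier `μ″ = μ(μ + 2(u − 1))∕ϖ^b`
next to the depth multiplier `μ′ = μ∕ϖ^a` (PRESCOPE-type2-rows §2 (L3)); the row-(2) cells are `levelSetDep(j, a; μ₁) ∩ {Λ ∣ μ₂·Λ^♯ ⊆ Λ} = levelSetDep(j, a; μ₁) ∩ levelSetDep(j, a; μ₂)`.
WHAT THIS FILE PROVES (type U: `M ∕ E` UNRAMIFIED; `ρ`, `Θ` isometric commuting involutions, `|α| ≤ 1`, `|α − ρα| = 1`, `ρϖE = ϖE`, `|ϖE| = exp(−1)`, `h ≠ 0` — EXACTLY the frame of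
★ T5a): **AT TYPE U THERE IS NO NEW TABLE EITHER.**  On every level stratum `levelSet(j, a)` the two-multiplier cell is the ONE-multiplier cell of the SHALLOWER multiplier
(`m₁ ≤ m₂`) or EMPTY, by a guard that does not see the lattice — `j + a ≤ m₂` or `|ρμ₁∕μ₁ − ρμ₂∕μ₂| ≤ exp(−((j + a) − m₂))`:
* §1 `v_depthUnit_sub_map_eq_twist` — `|z − ρz| = |θ + ρμ∕μ|` for the depth unit `z = μ∕(y·ϖE^{m−a})`, `θ = (ρh∕h)·(ρN∕N)` (★ T5a's `v_depthUnit_sub_map_eq` (1) WITHOUT the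
  `jλ` token; ★ `map_hermGen_eq_neg_mul`, ★ `div_sub_map_div_eq`).
* §2 `dep_and_dep_iff_of_witness` — u-free, on a presented `Λ = x₀·𝒪_j ∈ levelSet(j, a)`: `DEP(μ₁) ∧ DEP(μ₂) ⟺ DEP(μ₁) ∧ GUARD` (★ (D0) `dep_iff_of_witness` twice; both clauses
  put the SAME `θ` in closed balls `|θ + ρμᵢ∕μᵢ| ≤ exp(−((j + a) − mᵢ))` of nested radii — ultrametric balls are nested or disjoint).
* §3 `levelSetDep_inter_levelSetDep_eq` (set form), `levelSetDep_inter_depth_eq` (the literal (T5-P) spelling `∩ {Λ ∣ μ₂Λ^♯ ⊆ Λ}`), the primed twin (`m₂ ≤ m₁`) and the counted form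
  `ncard_levelSetDep_inter_eq`; §4 HEAD `ncard_levelSetDep_inter_eq_of_offDiag` — composed with ★ (R1-OFF) `ncard_levelSetDep_offDiag`: off the coincidence diagonal of `μ₁`
  (`a ≥ 1`, `j + m₁ ≠ jλ₁ + a`) the two-multiplier count is `[GUARD]·[2a ≤ m₁ ∧ (j + a ≤ m₁ ∨ j + a ≤ jλ₁)]·#levelSet(j, a)` (★ T5a tables); on the diagonal the ★ T5a
  diag-low ∕ top cells of `μ₁` stand behind the same guard (§3); §5 the WEIGHTED cone cell `Σᶠ_{Λ ∈ cell} f Λ = [GUARD]·Σᶠ_{Λ ∈ levelSetDep(j,a;μ₁)} f Λ` (any weight `f` —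
  the ★ T1 norm-residue weights of ★ (C1)'s cone term in particular).
The GUARD LETTER for the pair of record `(μ∕c, μν∕c′)` (`c, c′` `ρ`-fixed) is type-free and ★: `…RamMTwoMult.v_twist_sub_twist_eq` (`= |ν − ρν| ∕ |ν|`).
HONEST LABEL.  Count-neutral lattice bookkeeping over ★ organs; nothing printed is asserted; no census law is stated; `HC_CM` is proved only modulo the 7 printed citations (2 remaining
named inputs: hLiu418 = `stmt-HodgeConjecture-24832`, h413 = `stmt-HodgeConjecture-24833`) until rung 0 closes.

## References
* [Kottwitz1986BaseChangeUnits] R. E. Kottwitz, *Base change for unit elements of Hecke algebras*, Compositio Math. 60 (1986): §1 pp. 240–241 (fixed-lattice counts; the depth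
  condition `μ·Λ^♯ ⊆ Λ`).
* [Jacobowitz1962] R. Jacobowitz, *Hermitian forms over local fields*, Amer. J. Math. 84 (1962): §4 (dual lattices `Λ^♯ = y⁻¹Λ`, modular components).
* [Serre1979] J.-P. Serre, *Local Fields*, GTM 67 (1979): Ch. II §1 (the ultrametric inequality), Ch. III §6 Prop. 12 (orders of conductor `c`).
* [Flicker1998UnitaryFL] Y. Z. Flicker, *Elementary proof of the fundamental lemma for a unitary group*, Canad. J. Math. 50 (1998): Prop. 7 p. 84 (the level tables).
-/

set_option autoImplicit false

noncomputable section

namespace Summit.HodgeConjecture.HodgeConjecture.Cruxes.H413.F0P3cDyRamToricLevelCensusUnrTwoMult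

open WithZero
open Literature.NumberTheory.LocalFields.QuadraticOrder
open Summit.HodgeConjecture.HodgeConjecture.Cruxes.H413.F0P3cDyRamToricCensusDefs
open Summit.HodgeConjecture.HodgeConjecture.Cruxes.H413.F0P3cDyRamToricLevelCensusUnr

variable {K : Type*} [Field K] [Valued K ℤᵐ⁰] {ρ Θ : K →+* K} {α ϖE h : K}

/-! ## §1 The `ρ`-depth of the depth unit is the distance of the lattice twist `θ` to `−ρμ∕μ` -/

/-- **THE `ρ`-DEPTH OF THE DEPTH UNIT, `jλ`-FREE (type-U tokens).**  For `x₀ ≠ 0`, `y = h·x₀Θx₀·ϖE^j(α − ρα)` with `|y| = |ϖE|^a`, `a ≤ m`, `|μ| = exp(−m)`, the unit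
`z := μ∕(y·ϖE^{m−a})` has `|z − ρz| = |θ + ρμ∕μ|`, `θ := (ρh∕h)·(ρ(x₀Θx₀)∕(x₀Θx₀))` (`ρy = −θ·y`, ★ `map_hermGen_eq_neg_mul`; ★ `div_sub_map_div_eq`; `|z| = |θ| = 1`).
[cite: Jacobowitz1962, §4] [cite: Serre1979, Ch. III §6 Prop. 12] -/
theorem v_depthUnit_sub_map_eq_twist (hρρ : ∀ x, ρ (ρ x) = x) (hvρ : ∀ x, Valued.v (ρ x) = Valued.v x)
    (hρϖE : ρ ϖE = ϖE) (hϖE : Valued.v ϖE = exp (-1 : ℤ)) (hh : h ≠ 0)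
    {μ : K} {m : ℕ} (hm : Valued.v μ = exp (-(m : ℤ))) {j a : ℕ} (ham : a ≤ m) {x₀ : K} (hx₀ : x₀ ≠ 0)
    (hya : Valued.v (h * (x₀ * Θ x₀) * (ϖE ^ j * (α - ρ α))) = Valued.v ϖE ^ a) :
    Valued.v (μ / (h * (x₀ * Θ x₀) * (ϖE ^ j * (α - ρ α)) * ϖE ^ (m - a)) - ρ (μ / (h * (x₀ * Θ x₀) * (ϖE ^ j * (α - ρ α)) * ϖE ^ (m - a)))) =
      Valued.v (ρ h / h * (ρ (x₀ * Θ x₀) / (x₀ * Θ x₀)) + ρ μ / μ) := by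
  have hϖ0 : ϖE ≠ 0 := fun h0 => by rw [h0, map_zero] at hϖE; exact (exp_ne_zero hϖE.symm).elim
  have hμ0 : μ ≠ 0 := fun h0 => by rw [h0, map_zero] at hm; exact (exp_ne_zero hm.symm).elim
  have hΘx₀ : Θ x₀ ≠ 0 := fun h0 => by
    rw [h0, mul_zero, mul_zero, zero_mul, map_zero, v_pow_eq_exp_neg hϖE] at hya; exact (exp_ne_zero hya.symm).elim
  have hN0 : x₀ * Θ x₀ ≠ 0 := mul_ne_zero hx₀ hΘx₀
  have hc : ρ (ϖE ^ j) = ϖE ^ j := by rw [map_pow, hρϖE]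
  have hy0 : h * (x₀ * Θ x₀) * (ϖE ^ j * (α - ρ α)) ≠ 0 := fun h0 => by
    rw [h0, map_zero, v_pow_eq_exp_neg hϖE] at hya; exact (exp_ne_zero hya.symm).elim
  have hy'0 : h * (x₀ * Θ x₀) * (ϖE ^ j * (α - ρ α)) * ϖE ^ (m - a) ≠ 0 := mul_ne_zero hy0 (pow_ne_zero _ hϖ0)
  -- `ρ y' = −θ·y'` for `y' = y·ϖE^{m−a}`
  have hρy := map_hermGen_eq_neg_mul (ρ := ρ) (Θ := Θ) (α := α) hρρ hc hh hx₀ hΘx₀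
  have hρy' : ρ (h * (x₀ * Θ x₀) * (ϖE ^ j * (α - ρ α)) * ϖE ^ (m - a)) =
      -(ρ h / h * (ρ (x₀ * Θ x₀) / (x₀ * Θ x₀)) * (h * (x₀ * Θ x₀) * (ϖE ^ j * (α - ρ α)) * ϖE ^ (m - a))) := by
    rw [map_mul ρ _ (ϖE ^ (m - a)), map_pow, hρϖE, hρy]; ring
  have hθ : Valued.v (ρ h / h * (ρ (x₀ * Θ x₀) / (x₀ * Θ x₀))) = 1 := by
    rw [map_mul, map_div₀, map_div₀, hvρ, hvρ, div_self ((Valuation.ne_zero_iff _).2 hh),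
      div_self ((Valuation.ne_zero_iff _).2 hN0), mul_one]
  have hθ0 : ρ h / h * (ρ (x₀ * Θ x₀) / (x₀ * Θ x₀)) ≠ 0 := fun h0 => by rw [h0, map_zero] at hθ; exact zero_ne_one hθ
  have hvz : Valued.v (μ / (h * (x₀ * Θ x₀) * (ϖE ^ j * (α - ρ α)) * ϖE ^ (m - a))) = 1 := by
    rw [map_div₀, map_mul, hya, map_pow, hm, ← pow_add, Nat.add_sub_cancel' ham, v_pow_eq_exp_neg hϖE, div_self exp_ne_zero]
  rw [div_sub_map_div_eq (ρ := ρ) hρy' hθ0 hy'0 hμ0, map_mul, hvz, one_mul, map_div₀, hθ, div_one]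

/-! ## §2 Two multipliers on one presented lattice: the deeper clause follows from the shallower one behind a lattice-free guard -/

/-- **TWO-MULTIPLIER DEPTH TEST, u-FREE, type-U TOKENS.**  For a presented member `Λ = x₀·𝒪_j` of `levelSet(j, a)` (`y = dualGen x₀`, `|y| = |ϖE|^a`) and two multipliers with
`|μ₁| = exp(−m₁)`, `|μ₂| = exp(−m₂)`, `m₁ ≤ m₂` (so `μ₁` is the SHALLOWER one and its clause the binding one):
`(μ₁Λ^♯ ⊆ Λ ∧ μ₂Λ^♯ ⊆ Λ) ⟺ (μ₁Λ^♯ ⊆ Λ ∧ (j + a ≤ m₂ ∨ |ρμ₁∕μ₁ − ρμ₂∕μ₂| ≤ exp(−((j + a) − m₂))))`.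
By ★ (D0) each clause is `a ≤ mᵢ ∧ (j + a ≤ mᵢ ∨ |θ + ρμᵢ∕μᵢ| ≤ exp(−((j + a) − mᵢ)))` with the SAME lattice twist `θ` (§1); two closed balls for `θ` with nested radii are nested
(centres within the larger radius) or disjoint. [cite: Kottwitz1986BaseChangeUnits, §1 pp. 240–241] [cite: Jacobowitz1962, §4] [cite: Serre1979, Ch. II §1; Ch. III §6 Prop. 12] -/
theorem dep_and_dep_iff_of_witness (hρρ : ∀ x, ρ (ρ x) = x) (hvρ : ∀ x, Valued.v (ρ x) = Valued.v x) (hΘΘ : ∀ x, Θ (Θ x) = x) (hΘρ : ∀ x, Θ (ρ x) = ρ (Θ x))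
    (hvΘ : ∀ x, Valued.v (Θ x) = Valued.v x) (hα1 : Valued.v α ≤ 1) (hα : Valued.v (α - ρ α) = 1)
    (hρϖE : ρ ϖE = ϖE) (hϖE : Valued.v ϖE = exp (-1 : ℤ)) (hh : h ≠ 0)
    {μ₁ μ₂ : K} {m₁ m₂ : ℕ} (hm₁ : Valued.v μ₁ = exp (-(m₁ : ℤ))) (hm₂ : Valued.v μ₂ = exp (-(m₂ : ℤ))) (hle : m₁ ≤ m₂)
    {j a : ℕ} {Λ : AddSubgroup K} {x₀ : K} (hx₀ : x₀ ≠ 0)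
    (hΛ : ∀ x, x ∈ Λ ↔ ∃ z, IsOrd ρ α (ϖE ^ j) z ∧ x = x₀ * z) (hya : Valued.v (dualGen ρ Θ α (ϖE ^ j) h x₀) = Valued.v ϖE ^ a) :
    ((∀ b, (∀ x ∈ Λ, Valued.v (h * Θ x * b + ρ (h * Θ x * b)) ≤ 1) → μ₁ * b ∈ Λ) ∧
        (∀ b, (∀ x ∈ Λ, Valued.v (h * Θ x * b + ρ (h * Θ x * b)) ≤ 1) → μ₂ * b ∈ Λ)) ↔
      ((∀ b, (∀ x ∈ Λ, Valued.v (h * Θ x * b + ρ (h * Θ x * b)) ≤ 1) → μ₁ * b ∈ Λ) ∧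
        (j + a ≤ m₂ ∨ Valued.v (ρ μ₁ / μ₁ - ρ μ₂ / μ₂) ≤ exp (-((j + a : ℕ) - (m₂ : ℤ))))) := by
  rw [dep_iff_of_witness hρρ hvρ hΘΘ hΘρ hvΘ hα1 hα hρϖE hϖE hh hm₁ hx₀ hΛ hya,
    dep_iff_of_witness hρρ hvρ hΘΘ hΘρ hvΘ hα1 hα hρϖE hϖE hh hm₂ hx₀ hΛ hya]
  simp only [dualGen] at hya ⊢
  -- the two bounds are nested
  have hexp : exp (-((j + a : ℕ) - (m₁ : ℤ))) ≤ exp (-((j + a : ℕ) - (m₂ : ℤ))) := by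
    rw [exp_le_exp]; push_cast; omega
  set θ : K := ρ h / h * (ρ (x₀ * Θ x₀) / (x₀ * Θ x₀)) with hθdef
  constructor
  · rintro ⟨⟨ham₁, hor₁⟩, ⟨-, hor₂⟩⟩
    refine ⟨⟨ham₁, hor₁⟩, ?_⟩
    by_cases hjam₂ : j + a ≤ m₂
    · exact Or.inl hjam₂
    right
    have ham₂ : a ≤ m₂ := le_trans ham₁ hle
    have h₁ : Valued.v (θ + ρ μ₁ / μ₁) ≤ exp (-((j + a : ℕ) - (m₂ : ℤ))) := by
      rcases hor₁ with hjam₁ | hz₁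
      · exfalso; omega
      · rw [v_depthUnit_sub_map_eq_twist hρρ hvρ hρϖE hϖE hh hm₁ ham₁ hx₀ hya] at hz₁
        exact hz₁.trans hexp
    have h₂ : Valued.v (θ + ρ μ₂ / μ₂) ≤ exp (-((j + a : ℕ) - (m₂ : ℤ))) := by
      rcases hor₂ with hjam₂' | hz₂
      · exact absurd hjam₂' hjam₂
      · rwa [v_depthUnit_sub_map_eq_twist hρρ hvρ hρϖE hϖE hh hm₂ ham₂ hx₀ hya] at hz₂
    have hsub : ρ μ₁ / μ₁ - ρ μ₂ / μ₂ = (θ + ρ μ₁ / μ₁) - (θ + ρ μ₂ / μ₂) := by ring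
    rw [hsub]
    exact (Valuation.map_sub _ _ _).trans (max_le h₁ h₂)
  · rintro ⟨⟨ham₁, hor₁⟩, hG⟩
    have ham₂ : a ≤ m₂ := le_trans ham₁ hle
    refine ⟨⟨ham₁, hor₁⟩, ⟨ham₂, ?_⟩⟩
    by_cases hjam₂ : j + a ≤ m₂
    · exact Or.inl hjam₂
    right
    have hguard : Valued.v (ρ μ₁ / μ₁ - ρ μ₂ / μ₂) ≤ exp (-((j + a : ℕ) - (m₂ : ℤ))) := by
      rcases hG with hjam₂' | hG
      · exact absurd hjam₂' hjam₂
      · exact hG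
    have h₁ : Valued.v (θ + ρ μ₁ / μ₁) ≤ exp (-((j + a : ℕ) - (m₂ : ℤ))) := by
      rcases hor₁ with hjam₁ | hz₁
      · exfalso; omega
      · rw [v_depthUnit_sub_map_eq_twist hρρ hvρ hρϖE hϖE hh hm₁ ham₁ hx₀ hya] at hz₁
        exact hz₁.trans hexp
    rw [v_depthUnit_sub_map_eq_twist hρρ hvρ hρϖE hϖE hh hm₂ ham₂ hx₀ hya]
    have hadd : θ + ρ μ₂ / μ₂ = (θ + ρ μ₁ / μ₁) - (ρ μ₁ / μ₁ - ρ μ₂ / μ₂) := by ring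
    rw [hadd]
    exact (Valuation.map_sub _ _ _).trans (max_le h₁ hguard)

/-! ## §3 The two-multiplier cells of the type-U census -/

/-- **THE TWO-MULTIPLIER CELL IS A ONE-MULTIPLIER CELL OR EMPTY (type U, set form).**  For `|μ₁| = exp(−m₁)`, `|μ₂| = exp(−m₂)`, `m₁ ≤ m₂` and every `(j, a)`:
`levelSetDep(j,a;μ₁) ∩ levelSetDep(j,a;μ₂) = if (j + a ≤ m₂ ∨ |ρμ₁∕μ₁ − ρμ₂∕μ₂| ≤ exp(−((j + a) − m₂))) then levelSetDep(j,a;μ₁) else ∅` — the guard is a letter of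
`(j, a, μ₁, μ₂)`, not of the lattice. [cite: Kottwitz1986BaseChangeUnits, §1 pp. 240–241] [cite: Jacobowitz1962, §4] [cite: Serre1979, Ch. II §1] -/
theorem levelSetDep_inter_levelSetDep_eq (hρρ : ∀ x, ρ (ρ x) = x) (hvρ : ∀ x, Valued.v (ρ x) = Valued.v x) (hΘΘ : ∀ x, Θ (Θ x) = x)
    (hΘρ : ∀ x, Θ (ρ x) = ρ (Θ x)) (hvΘ : ∀ x, Valued.v (Θ x) = Valued.v x) (hα1 : Valued.v α ≤ 1) (hα : Valued.v (α - ρ α) = 1)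
    (hρϖE : ρ ϖE = ϖE) (hϖE : Valued.v ϖE = exp (-1 : ℤ)) (hh : h ≠ 0)
    {μ₁ μ₂ : K} {m₁ m₂ : ℕ} (hm₁ : Valued.v μ₁ = exp (-(m₁ : ℤ))) (hm₂ : Valued.v μ₂ = exp (-(m₂ : ℤ))) (hle : m₁ ≤ m₂) (j a : ℕ) :
    levelSetDep ρ Θ α ϖE h j a μ₁ ∩ levelSetDep ρ Θ α ϖE h j a μ₂ =
      if j + a ≤ m₂ ∨ Valued.v (ρ μ₁ / μ₁ - ρ μ₂ / μ₂) ≤ exp (-((j + a : ℕ) - (m₂ : ℤ)))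
      then levelSetDep ρ Θ α ϖE h j a μ₁ else ∅ := by
  ext Λ
  rw [Set.mem_inter_iff, mem_levelSetDep_iff, mem_levelSetDep_iff]
  constructor
  · rintro ⟨⟨hΛ, hdep₁⟩, ⟨-, hdep₂⟩⟩
    obtain ⟨x₀, hx₀, hΛx, hyO, hyN, hya⟩ := hΛ
    have hG := ((dep_and_dep_iff_of_witness hρρ hvρ hΘΘ hΘρ hvΘ hα1 hα hρϖE hϖE hh hm₁ hm₂ hle hx₀ hΛx hya).1 ⟨hdep₁, hdep₂⟩).2
    rw [if_pos hG, mem_levelSetDep_iff]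
    exact ⟨⟨x₀, hx₀, hΛx, hyO, hyN, hya⟩, hdep₁⟩
  · intro hΛ
    split_ifs at hΛ with hG
    · rw [mem_levelSetDep_iff] at hΛ
      obtain ⟨hΛ, hdep₁⟩ := hΛ
      obtain ⟨x₀, hx₀, hΛx, hyO, hyN, hya⟩ := hΛ
      have h2 := (dep_and_dep_iff_of_witness hρρ hvρ hΘΘ hΘρ hvΘ hα1 hα hρϖE hϖE hh hm₁ hm₂ hle hx₀ hΛx hya).2 ⟨hdep₁, hG⟩
      exact ⟨⟨⟨x₀, hx₀, hΛx, hyO, hyN, hya⟩, h2.1⟩, ⟨⟨x₀, hx₀, hΛx, hyO, hyN, hya⟩, h2.2⟩⟩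
    · exact absurd hΛ (Set.notMem_empty Λ)

/-- **THE (T5-P) SPELLING `levelSetDep(j,a;μ₁) ∩ {Λ ∣ μ₂·Λ^♯ ⊆ Λ}`** (the square clause as a SECOND multiplier next to the first): the same reduction,
`= if GUARD then levelSetDep(j,a;μ₁) else ∅` (`m₁ ≤ m₂`). [cite: Kottwitz1986BaseChangeUnits, §1 pp. 240–241] [cite: Jacobowitz1962, §4] -/
theorem levelSetDep_inter_depth_eq (hρρ : ∀ x, ρ (ρ x) = x) (hvρ : ∀ x, Valued.v (ρ x) = Valued.v x) (hΘΘ : ∀ x, Θ (Θ x) = x)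
    (hΘρ : ∀ x, Θ (ρ x) = ρ (Θ x)) (hvΘ : ∀ x, Valued.v (Θ x) = Valued.v x) (hα1 : Valued.v α ≤ 1) (hα : Valued.v (α - ρ α) = 1)
    (hρϖE : ρ ϖE = ϖE) (hϖE : Valued.v ϖE = exp (-1 : ℤ)) (hh : h ≠ 0)
    {μ₁ μ₂ : K} {m₁ m₂ : ℕ} (hm₁ : Valued.v μ₁ = exp (-(m₁ : ℤ))) (hm₂ : Valued.v μ₂ = exp (-(m₂ : ℤ))) (hle : m₁ ≤ m₂) (j a : ℕ) :
    levelSetDep ρ Θ α ϖE h j a μ₁ ∩ {Λ | ∀ b, (∀ x ∈ Λ, Valued.v (h * Θ x * b + ρ (h * Θ x * b)) ≤ 1) → μ₂ * b ∈ Λ} =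
      if j + a ≤ m₂ ∨ Valued.v (ρ μ₁ / μ₁ - ρ μ₂ / μ₂) ≤ exp (-((j + a : ℕ) - (m₂ : ℤ)))
      then levelSetDep ρ Θ α ϖE h j a μ₁ else ∅ := by
  rw [← levelSetDep_inter_levelSetDep_eq hρρ hvρ hΘΘ hΘρ hvΘ hα1 hα hρϖE hϖE hh hm₁ hm₂ hle j a]
  ext Λ
  simp only [Set.mem_inter_iff, Set.mem_setOf_eq, mem_levelSetDep_iff]
  exact ⟨fun ⟨⟨hΛ, h1⟩, h2⟩ => ⟨⟨hΛ, h1⟩, hΛ, h2⟩, fun ⟨⟨hΛ, h1⟩, _, h2⟩ => ⟨⟨hΛ, h1⟩, h2⟩⟩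

/-- **THE SHALLOWER MULTIPLIER ON THE RIGHT** (`m₂ ≤ m₁`): `levelSetDep(j,a;μ₁) ∩ levelSetDep(j,a;μ₂) = if GUARD′ then levelSetDep(j,a;μ₂) else ∅` with the guard read at `m₁`
(`Set.inter_comm` + §3). [cite: Kottwitz1986BaseChangeUnits, §1 pp. 240–241] -/
theorem levelSetDep_inter_levelSetDep_eq' (hρρ : ∀ x, ρ (ρ x) = x) (hvρ : ∀ x, Valued.v (ρ x) = Valued.v x) (hΘΘ : ∀ x, Θ (Θ x) = x)
    (hΘρ : ∀ x, Θ (ρ x) = ρ (Θ x)) (hvΘ : ∀ x, Valued.v (Θ x) = Valued.v x) (hα1 : Valued.v α ≤ 1) (hα : Valued.v (α - ρ α) = 1)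
    (hρϖE : ρ ϖE = ϖE) (hϖE : Valued.v ϖE = exp (-1 : ℤ)) (hh : h ≠ 0)
    {μ₁ μ₂ : K} {m₁ m₂ : ℕ} (hm₁ : Valued.v μ₁ = exp (-(m₁ : ℤ))) (hm₂ : Valued.v μ₂ = exp (-(m₂ : ℤ))) (hle : m₂ ≤ m₁) (j a : ℕ) :
    levelSetDep ρ Θ α ϖE h j a μ₁ ∩ levelSetDep ρ Θ α ϖE h j a μ₂ =
      if j + a ≤ m₁ ∨ Valued.v (ρ μ₂ / μ₂ - ρ μ₁ / μ₁) ≤ exp (-((j + a : ℕ) - (m₁ : ℤ)))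
      then levelSetDep ρ Θ α ϖE h j a μ₂ else ∅ := by
  rw [Set.inter_comm]
  exact levelSetDep_inter_levelSetDep_eq hρρ hvρ hΘΘ hΘρ hvΘ hα1 hα hρϖE hϖE hh hm₂ hm₁ hle j a

/-- **THE TWO-MULTIPLIER CELL, COUNTED**: `#(levelSetDep(j,a;μ₁) ∩ levelSetDep(j,a;μ₂)) = if GUARD then #levelSetDep(j,a;μ₁) else 0` (`m₁ ≤ m₂`) — every two-multiplier
type-U table is the ★ one-multiplier table of the shallower multiplier behind the guard. [cite: Flicker1998UnitaryFL, Prop. 7 p. 84] [cite: Kottwitz1986BaseChangeUnits, §1 pp. 240–241] -/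
theorem ncard_levelSetDep_inter_eq (hρρ : ∀ x, ρ (ρ x) = x) (hvρ : ∀ x, Valued.v (ρ x) = Valued.v x) (hΘΘ : ∀ x, Θ (Θ x) = x)
    (hΘρ : ∀ x, Θ (ρ x) = ρ (Θ x)) (hvΘ : ∀ x, Valued.v (Θ x) = Valued.v x) (hα1 : Valued.v α ≤ 1) (hα : Valued.v (α - ρ α) = 1)
    (hρϖE : ρ ϖE = ϖE) (hϖE : Valued.v ϖE = exp (-1 : ℤ)) (hh : h ≠ 0)
    {μ₁ μ₂ : K} {m₁ m₂ : ℕ} (hm₁ : Valued.v μ₁ = exp (-(m₁ : ℤ))) (hm₂ : Valued.v μ₂ = exp (-(m₂ : ℤ))) (hle : m₁ ≤ m₂) (j a : ℕ) :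
    (levelSetDep ρ Θ α ϖE h j a μ₁ ∩ levelSetDep ρ Θ α ϖE h j a μ₂).ncard =
      if j + a ≤ m₂ ∨ Valued.v (ρ μ₁ / μ₁ - ρ μ₂ / μ₂) ≤ exp (-((j + a : ℕ) - (m₂ : ℤ)))
      then (levelSetDep ρ Θ α ϖE h j a μ₁).ncard else 0 := by
  rw [levelSetDep_inter_levelSetDep_eq hρρ hvρ hΘΘ hΘρ hvΘ hα1 hα hρϖE hϖE hh hm₁ hm₂ hle j a]
  split_ifs
  · rfl
  · exact Set.ncard_empty _

/-! ## §4 … composed with the ★ u-free one-multiplier rule (R1-OFF) -/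

/-- **THE TWO-MULTIPLIER TABLE OFF THE COINCIDENCE DIAGONAL OF THE SHALLOWER MULTIPLIER** (★ T5a `ncard_levelSetDep_offDiag` behind the guard): with the tree token
`|μ₁ − ρμ₁| = exp(−jλ₁)`, `a ≥ 1` and `j + m₁ ≠ jλ₁ + a`:
`#(levelSetDep(j,a;μ₁) ∩ levelSetDep(j,a;μ₂)) = [GUARD]·[2a ≤ m₁ ∧ (j + a ≤ m₁ ∨ j + a ≤ jλ₁)]·#levelSet(j,a)` — `#levelSet(j,a)` is the ★ T5a level table.  (At `a = 0` and on the
diagonal the ★ rows `ncard_levelSetDep_zero` ∕ `ncard_levelSetDep_diag_low` ∕ the T5a top cells of `μ₁` take the place of the bracket, behind the same guard — §3.)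
[cite: Flicker1998UnitaryFL, Prop. 7 p. 84] [cite: Kottwitz1986BaseChangeUnits, §1 pp. 240–241] [cite: Jacobowitz1962, §4] -/
theorem ncard_levelSetDep_inter_eq_of_offDiag (hρρ : ∀ x, ρ (ρ x) = x) (hvρ : ∀ x, Valued.v (ρ x) = Valued.v x) (hΘΘ : ∀ x, Θ (Θ x) = x)
    (hΘρ : ∀ x, Θ (ρ x) = ρ (Θ x)) (hvΘ : ∀ x, Valued.v (Θ x) = Valued.v x) (hα1 : Valued.v α ≤ 1) (hα : Valued.v (α - ρ α) = 1)
    (hρϖE : ρ ϖE = ϖE) (hϖE : Valued.v ϖE = exp (-1 : ℤ)) (hh : h ≠ 0)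
    {μ₁ μ₂ : K} {m₁ m₂ jl₁ : ℕ} (hm₁ : Valued.v μ₁ = exp (-(m₁ : ℤ))) (hjl₁ : Valued.v (μ₁ - ρ μ₁) = exp (-(jl₁ : ℤ)))
    (hm₂ : Valued.v μ₂ = exp (-(m₂ : ℤ))) (hle : m₁ ≤ m₂)
    {j a : ℕ} (ha : 1 ≤ a) (hoff : j + m₁ ≠ jl₁ + a) :
    (levelSetDep ρ Θ α ϖE h j a μ₁ ∩ levelSetDep ρ Θ α ϖE h j a μ₂).ncard =
      if j + a ≤ m₂ ∨ Valued.v (ρ μ₁ / μ₁ - ρ μ₂ / μ₂) ≤ exp (-((j + a : ℕ) - (m₂ : ℤ)))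
      then (if 2 * a ≤ m₁ ∧ (j + a ≤ m₁ ∨ j + a ≤ jl₁) then (levelSet ρ Θ α ϖE h j a).ncard else 0) else 0 := by
  rw [ncard_levelSetDep_inter_eq hρρ hvρ hΘΘ hΘρ hvΘ hα1 hα hρϖE hϖE hh hm₁ hm₂ hle j a,
    ncard_levelSetDep_offDiag hρρ hvρ hΘΘ hΘρ hvΘ hα1 hα hρϖE hϖE hh hm₁ hjl₁ ha hoff]

/-! ## §5 The WEIGHTED two-multiplier cone cell — the shape ★ (C1) ∕ ★ p858894 actually sum (LH4-p07 (g8) ROW-(2) LETTERS (i)) -/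

/-- **THE WEIGHTED TWO-MULTIPLIER CONE CELL (type U)**: the square-token cone cells of ★ (C1) p857559 ∕ ★ p858894 are summed with the ★ T1 norm-residue WEIGHTS
`f b j Λ = #Sol_{2b}(r_Λ)` (a `Σᶠ` over the cell); for ANY weight `f` into an additive commutative monoid and `m₁ ≤ m₂`,
`Σᶠ_{Λ ∈ levelSetDep(j,a;μ₁) ∩ levelSetDep(j,a;μ₂)} f Λ = if GUARD then Σᶠ_{Λ ∈ levelSetDep(j,a;μ₁)} f Λ else 0` — every weighted two-multiplier type-U cone sum is the ★ one-multiplier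
O-Cone ∕ O-Sum term of the shallower multiplier behind the guard (§3; `finsum_mem_empty`). [cite: Kottwitz1986BaseChangeUnits, §1 pp. 240–241] [cite: Jacobowitz1962, §4] [cite: Serre1979, Ch. II §1] -/
theorem finsum_mem_inter_levelSetDep_eq (hρρ : ∀ x, ρ (ρ x) = x) (hvρ : ∀ x, Valued.v (ρ x) = Valued.v x) (hΘΘ : ∀ x, Θ (Θ x) = x)
    (hΘρ : ∀ x, Θ (ρ x) = ρ (Θ x)) (hvΘ : ∀ x, Valued.v (Θ x) = Valued.v x) (hα1 : Valued.v α ≤ 1) (hα : Valued.v (α - ρ α) = 1)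
    (hρϖE : ρ ϖE = ϖE) (hϖE : Valued.v ϖE = exp (-1 : ℤ)) (hh : h ≠ 0)
    {μ₁ μ₂ : K} {m₁ m₂ : ℕ} (hm₁ : Valued.v μ₁ = exp (-(m₁ : ℤ))) (hm₂ : Valued.v μ₂ = exp (-(m₂ : ℤ))) (hle : m₁ ≤ m₂) (j a : ℕ)
    {M : Type*} [AddCommMonoid M] (f : AddSubgroup K → M) :
    ∑ᶠ Λ ∈ levelSetDep ρ Θ α ϖE h j a μ₁ ∩ levelSetDep ρ Θ α ϖE h j a μ₂, f Λ =
      if j + a ≤ m₂ ∨ Valued.v (ρ μ₁ / μ₁ - ρ μ₂ / μ₂) ≤ exp (-((j + a : ℕ) - (m₂ : ℤ)))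
      then ∑ᶠ Λ ∈ levelSetDep ρ Θ α ϖE h j a μ₁, f Λ else 0 := by
  rw [levelSetDep_inter_levelSetDep_eq hρρ hvρ hΘΘ hΘρ hvΘ hα1 hα hρϖE hϖE hh hm₁ hm₂ hle j a]
  split_ifs
  · rfl
  · exact finsum_mem_empty

/-- **THE WEIGHTED CELL IN THE (T5-P) SPELLING** `levelSetDep(j,a;μ₁) ∩ {Λ ∣ μ₂·Λ^♯ ⊆ Λ}`: the same weighted reduction. [cite: Kottwitz1986BaseChangeUnits, §1 pp. 240–241] [cite: Jacobowitz1962, §4] -/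
theorem finsum_mem_levelSetDep_inter_depth_eq (hρρ : ∀ x, ρ (ρ x) = x) (hvρ : ∀ x, Valued.v (ρ x) = Valued.v x) (hΘΘ : ∀ x, Θ (Θ x) = x)
    (hΘρ : ∀ x, Θ (ρ x) = ρ (Θ x)) (hvΘ : ∀ x, Valued.v (Θ x) = Valued.v x) (hα1 : Valued.v α ≤ 1) (hα : Valued.v (α - ρ α) = 1)
    (hρϖE : ρ ϖE = ϖE) (hϖE : Valued.v ϖE = exp (-1 : ℤ)) (hh : h ≠ 0)
    {μ₁ μ₂ : K} {m₁ m₂ : ℕ} (hm₁ : Valued.v μ₁ = exp (-(m₁ : ℤ))) (hm₂ : Valued.v μ₂ = exp (-(m₂ : ℤ))) (hle : m₁ ≤ m₂) (j a : ℕ)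
    {M : Type*} [AddCommMonoid M] (f : AddSubgroup K → M) :
    ∑ᶠ Λ ∈ levelSetDep ρ Θ α ϖE h j a μ₁ ∩ {Λ | ∀ b, (∀ x ∈ Λ, Valued.v (h * Θ x * b + ρ (h * Θ x * b)) ≤ 1) → μ₂ * b ∈ Λ}, f Λ =
      if j + a ≤ m₂ ∨ Valued.v (ρ μ₁ / μ₁ - ρ μ₂ / μ₂) ≤ exp (-((j + a : ℕ) - (m₂ : ℤ)))
      then ∑ᶠ Λ ∈ levelSetDep ρ Θ α ϖE h j a μ₁, f Λ else 0 := by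
  rw [levelSetDep_inter_depth_eq hρρ hvρ hΘΘ hΘρ hvΘ hα1 hα hρϖE hϖE hh hm₁ hm₂ hle j a]
  split_ifs
  · rfl
  · exact finsum_mem_empty

end Summit.HodgeConjecture.HodgeConjecture.Cruxes.H413.F0P3cDyRamToricLevelCensusUnrTwoMult

end
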